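import Summits.AtomisticToContinuum.BoseEinsteinCondensation.Theses.BECConjugateDomination
import Summits.AtomisticToContinuum.BoseEinsteinCondensation.Theorems.PuffFloor.Negative.FreeGasModel
import Literature.MathematicalPhysics.QuantumManyBody.RelativeFisherInformation

/-!
# Route `BECConjugateDomination`, crux `PuffFloor` (stmt-AtomisticToContinuum-11785),
# line `coupling-slope-pocket`, stub S6: uniqueness of the positive minimiser

Supports (does not close) stmt-AtomisticToContinuum-11785. On the torus of side `L > 0`, two
exact minimisers `Ψ₁, Ψ₂` of the periodic `(n+1)`-body energy (measurable pair profile `v`,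
finite ground-state energy) that are both real, non-negative and nowhere zero coincide.

Proof (convexity of `ρ ↦ ∫|∇√ρ|²`; `C¹` suffices, no spectral theory). Write `Ψᵢ = ψᵢ`,
`ψᵢ > 0` real `C¹`. The state `Φ = √((ψ₁² + ψ₂²)/2)` is admissible and, for every partial
derivative `∂`, the Lagrange identity
`½(∂ψ₁)² + ½(∂ψ₂)² - (∂Φ)² = (ψ₂∂ψ₁ - ψ₁∂ψ₂)²/(2(ψ₁²+ψ₂²)) = (∂(ψ₁/ψ₂))² ψ₂⁴/(2(ψ₁²+ψ₂²))`
holds pointwise, the potential term being affine in `ρ = |Ψ|²`. Hence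
`E[Φ] + ∫ defect = ½E[Ψ₁] + ½E[Ψ₂] = E₀ ≤ E[Φ]`: the defect has zero integral over the cell, so
the relative Fisher information `4∫|∇(ψ₁/ψ₂)|²ψ₂²` vanishes on the open box `(0,L)^{3N}` and
`ψ₁ = cψ₂` there (`exists_eq_const_mul_of_relativeFisherInformation_eq_zero`: continuity and
the mean value theorem on the convex open box); the identity extends to the cell by continuity
along the segment towards the centre, to `(ℝ³)^N` by periodicity, and `c = 1` by normalisation.

References: Lieb–Seiringer–Solovej–Yngvason, *The Mathematics of the Bose Gas and its
Condensation* (2005), Ch. 6, Thm. 6.1 / App. A (unique positive minimiser by convexity of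
`ρ ↦ ∫|∇√ρ|²`); Reed–Simon IV (1978), §XIII.12 (non-degenerate positive ground states).
-/

noncomputable section

namespace Summit.AtomisticToContinuum.BoseEinsteinCondensation.Theorems

open MeasureTheory Filter
open scoped ENNReal NNReal BigOperators
open Literature.MathematicalPhysics.QuantumManyBody.BoseGas
open Summit.AtomisticToContinuum.BoseEinsteinCondensation.Theses.BECConjugateDomination
open Summit.AtomisticToContinuum.BoseEinsteinCondensation.Theorems.PuffFloor.Negative

namespace PositiveMinimiserUnique

variable {N : ℕ} {L : ℝ}

/-- `ofReal (2⁻¹x) = 2⁻¹ ofReal x`. [folklore] -/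
theorem ofReal_half_mul (x : ℝ) : ENNReal.ofReal (2⁻¹ * x) = 2⁻¹ * ENNReal.ofReal x := by
  rw [ENNReal.ofReal_mul (by norm_num), ENNReal.ofReal_inv_of_pos two_pos, ENNReal.ofReal_ofNat]

/-! ## Real representatives of real non-negative nowhere-vanishing states -/

/-- A real, non-negative, nowhere-vanishing `C¹` wave function is the complexification of a
strictly positive real `C¹` function (its real part). [folklore] -/
theorem exists_realRep (Ψ : PeriodicTrialState N L) (hreal : ∀ X, Ψ.ψ X = (‖Ψ.ψ X‖ : ℂ))
    (hne : ∀ X, Ψ.ψ X ≠ 0) :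
    ∃ ψ : Config N → ℝ, ContDiff ℝ 1 ψ ∧ (∀ X, 0 < ψ X) ∧ Ψ.ψ = fun X => (ψ X : ℂ) := by
  refine ⟨fun X => (Ψ.ψ X).re, Complex.reCLM.contDiff.comp Ψ.contDiff, fun X => ?_,
    funext fun X => ?_⟩
  · show 0 < (Ψ.ψ X).re
    rw [hreal X, Complex.ofReal_re]
    exact norm_pos_iff.2 (hne X)
  · show Ψ.ψ X = (((Ψ.ψ X).re : ℝ) : ℂ)
    rw [hreal X, Complex.ofReal_re]

/-- The real representative inherits the torus periodicity. [folklore] -/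
theorem isTorusPeriodic_of_eq (Ψ : PeriodicTrialState N L) {ψ : Config N → ℝ}
    (hfun : Ψ.ψ = fun X => (ψ X : ℂ)) : IsTorusPeriodic L ψ :=
  fun X i k => by simpa [hfun] using Ψ.periodic X i k

/-- The real representative inherits the Bose symmetry. [folklore] -/
theorem symm_of_eq (Ψ : PeriodicTrialState N L) {ψ : Config N → ℝ}
    (hfun : Ψ.ψ = fun X => (ψ X : ℂ)) (σ : Equiv.Perm (Fin N)) (X : Config N) :
    ψ (X ∘ σ) = ψ X := by
  simpa [hfun] using Ψ.symm σ X

/-- The real representative inherits the normalisation `∫_{cell} ψ² = 1`. [folklore] -/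
theorem lintegral_sq_of_eq (Ψ : PeriodicTrialState N L) {ψ : Config N → ℝ}
    (hfun : Ψ.ψ = fun X => (ψ X : ℂ)) : ∫⁻ X in cellN N L, ENNReal.ofReal (ψ X ^ 2) = 1 := by
  simpa only [hfun, coe_nnnorm_sq_eq_ofReal, Complex.norm_real, Real.norm_eq_abs, sq_abs]
    using Ψ.norm_eq

/-- Two periodic trial states with the same wave function are equal (the other fields are
propositions). [folklore] -/
theorem trialState_eq_of_eq {Ψ₁ Ψ₂ : PeriodicTrialState N L} (h : Ψ₁.ψ = Ψ₂.ψ) : Ψ₁ = Ψ₂ := by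
  rcases Ψ₁ with ⟨f₁, _, _, _, _⟩
  rcases Ψ₂ with ⟨f₂, _, _, _, _⟩
  simp only at h
  subst h
  rfl

/-- Directional derivative of `√((ψ₁² + ψ₂²)/2)`:
`∂√((ψ₁²+ψ₂²)/2) = (ψ₁∂ψ₁ + ψ₂∂ψ₂)/(2√((ψ₁²+ψ₂²)/2))`. [folklore] -/
theorem fderiv_sqrtMean_apply {ψ₁ ψ₂ : Config N → ℝ} {X : Config N}
    (h₁ : DifferentiableAt ℝ ψ₁ X) (h₂ : DifferentiableAt ℝ ψ₂ X)
    (hpos : 0 < ψ₁ X ^ 2 + ψ₂ X ^ 2) (V : Config N) :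
    fderiv ℝ (fun Y => Real.sqrt (2⁻¹ * (ψ₁ Y ^ 2 + ψ₂ Y ^ 2))) X V =
      (ψ₁ X * fderiv ℝ ψ₁ X V + ψ₂ X * fderiv ℝ ψ₂ X V) /
        (2 * Real.sqrt (2⁻¹ * (ψ₁ X ^ 2 + ψ₂ X ^ 2))) := by
  have hm0 : 0 < 2⁻¹ * (ψ₁ X ^ 2 + ψ₂ X ^ 2) := by positivity
  have hs : Real.sqrt (2⁻¹ * (ψ₁ X ^ 2 + ψ₂ X ^ 2)) ≠ 0 := (Real.sqrt_pos.2 hm0).ne'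
  have hF : HasFDerivAt (fun Y => Real.sqrt (2⁻¹ * (ψ₁ Y ^ 2 + ψ₂ Y ^ 2))) _ X :=
    (((h₁.hasFDerivAt.pow 2).add (h₂.hasFDerivAt.pow 2)).const_mul (2⁻¹ : ℝ)).sqrt hm0.ne'
  rw [hF.fderiv]
  simp only [smul_apply, add_apply, Pi.add_apply, smul_eq_mul, nsmul_eq_mul, Nat.cast_ofNat,
    Nat.add_one_sub_one, pow_one]
  field_simp

/-- Directional derivative of the ratio: `∂(ψ₁/ψ₂) = (ψ₂∂ψ₁ - ψ₁∂ψ₂)/ψ₂²`. [folklore] -/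
theorem fderiv_ratio_apply {ψ₁ ψ₂ : Config N → ℝ} {X : Config N}
    (h₁ : DifferentiableAt ℝ ψ₁ X) (h₂ : DifferentiableAt ℝ ψ₂ X) (hne : ψ₂ X ≠ 0)
    (V : Config N) :
    fderiv ℝ (fun Y => ψ₁ Y / ψ₂ Y) X V =
      (ψ₂ X * fderiv ℝ ψ₁ X V - ψ₁ X * fderiv ℝ ψ₂ X V) / ψ₂ X ^ 2 := by
  have h := h₁.hasFDerivAt.mul ((hasDerivAt_inv hne).comp_hasFDerivAt X h₂.hasFDerivAt)
  have hfun : (fun Y => ψ₁ Y / ψ₂ Y) = ψ₁ * ((fun y : ℝ => y⁻¹) ∘ ψ₂) := by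
    funext Y
    simp [div_eq_mul_inv]
  rw [hfun, h.fderiv]
  simp only [add_apply, smul_apply, smul_eq_mul, Function.comp_apply]
  field_simp
  ring

/-- **Lagrange identity, one direction at a time** (the convexity of `ρ ↦ |∇√ρ|²`): with
`Φ = √((ψ₁²+ψ₂²)/2)`, `|∂Φ|² + |∂(ψ₁/ψ₂)|² ψ₂⁴/(2(ψ₁²+ψ₂²)) = ½|∂ψ₁|² + ½|∂ψ₂|²`, i.e.
`½|∂ψ₁|² + ½|∂ψ₂|² - |∂Φ|² = (ψ₂∂ψ₁ - ψ₁∂ψ₂)²/(2(ψ₁²+ψ₂²))`, in `ℝ≥0∞`. [folklore] -/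
theorem term_identity {ψ₁ ψ₂ : Config N → ℝ} {X : Config N}
    (h₁ : DifferentiableAt ℝ ψ₁ X) (h₂ : DifferentiableAt ℝ ψ₂ X) (hpos₂ : 0 < ψ₂ X)
    (V : Config N) :
    ((‖fderiv ℝ (fun Y => Real.sqrt (2⁻¹ * (ψ₁ Y ^ 2 + ψ₂ Y ^ 2))) X V‖₊ : ℝ≥0∞)) ^ 2 +
      ((‖fderiv ℝ (fun Y => ψ₁ Y / ψ₂ Y) X V‖₊ : ℝ≥0∞)) ^ 2 *
        ENNReal.ofReal (ψ₂ X ^ 4 / (2 * (ψ₁ X ^ 2 + ψ₂ X ^ 2))) =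
    2⁻¹ * ((‖fderiv ℝ ψ₁ X V‖₊ : ℝ≥0∞)) ^ 2 + 2⁻¹ * ((‖fderiv ℝ ψ₂ X V‖₊ : ℝ≥0∞)) ^ 2 := by
  have hsum : 0 < ψ₁ X ^ 2 + ψ₂ X ^ 2 := by positivity
  simp only [coe_nnnorm_sq_eq_ofReal, Real.norm_eq_abs, sq_abs]
  rw [fderiv_sqrtMean_apply h₁ h₂ hsum, fderiv_ratio_apply h₁ h₂ hpos₂.ne',
    ← ENNReal.ofReal_mul (sq_nonneg _), ← ENNReal.ofReal_add (sq_nonneg _) (by positivity),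
    ← ofReal_half_mul, ← ofReal_half_mul, ← ENNReal.ofReal_add (by positivity) (by positivity)]
  congr 1
  have hm0 : 0 < 2⁻¹ * (ψ₁ X ^ 2 + ψ₂ X ^ 2) := by positivity
  have hs2 : Real.sqrt (2⁻¹ * (ψ₁ X ^ 2 + ψ₂ X ^ 2)) ^ 2 = 2⁻¹ * (ψ₁ X ^ 2 + ψ₂ X ^ 2) :=
    Real.sq_sqrt hm0.le
  have hs0 : Real.sqrt (2⁻¹ * (ψ₁ X ^ 2 + ψ₂ X ^ 2)) ≠ 0 := (Real.sqrt_pos.2 hm0).ne'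
  have hb0 : ψ₂ X ≠ 0 := hpos₂.ne'
  rw [div_pow, mul_pow, hs2, div_pow]
  field_simp
  ring

/-- **The kinetic identity**, summed over all `3N` partial derivatives:
`|∇Φ|² + (∑|∂(ψ₁/ψ₂)|²) ψ₂⁴/(2(ψ₁²+ψ₂²)) = ½|∇ψ₁|² + ½|∇ψ₂|²` for the complexified states.
[folklore] -/
theorem kinetic_identity {ψ₁ ψ₂ : Config N → ℝ} (hC₁ : ContDiff ℝ 1 ψ₁) (hC₂ : ContDiff ℝ 1 ψ₂)
    (hpos₂ : ∀ X, 0 < ψ₂ X) (X : Config N) :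
    kineticDensity (fun Y => ((Real.sqrt (2⁻¹ * (ψ₁ Y ^ 2 + ψ₂ Y ^ 2)) : ℝ) : ℂ)) X +
      (∑ i : Fin N, ∑ a : Fin 3, ((‖fderiv ℝ (fun Y => ψ₁ Y / ψ₂ Y) X
          (Pi.single i (EuclideanSpace.single a (1 : ℝ)))‖₊ : ℝ≥0∞)) ^ 2) *
        ENNReal.ofReal (ψ₂ X ^ 4 / (2 * (ψ₁ X ^ 2 + ψ₂ X ^ 2))) =
    2⁻¹ * kineticDensity (fun Y => ((ψ₁ Y : ℝ) : ℂ)) X +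
      2⁻¹ * kineticDensity (fun Y => ((ψ₂ Y : ℝ) : ℂ)) X := by
  simp only [kineticDensity, nnnorm_fderiv_ofReal_comp_apply, Finset.sum_mul, Finset.mul_sum,
    ← Finset.sum_add_distrib]
  refine Finset.sum_congr rfl fun i _ => Finset.sum_congr rfl fun a _ => ?_
  exact term_identity (hC₁.differentiable one_ne_zero X) (hC₂.differentiable one_ne_zero X)
    (hpos₂ X) _

/-- The mean-density state `Φ = √((ψ₁² + ψ₂²)/2)` of two positive real representatives is an
admissible periodic trial state (`C¹` since `ψ₁² + ψ₂² > 0`, periodic, symmetric, and normalised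
because `|Φ|² = ½ψ₁² + ½ψ₂²`). [folklore] -/
theorem exists_meanState (Ψ₁ Ψ₂ : PeriodicTrialState N L) {ψ₁ ψ₂ : Config N → ℝ}
    (hC₁ : ContDiff ℝ 1 ψ₁) (hC₂ : ContDiff ℝ 1 ψ₂) (hpos₂ : ∀ X, 0 < ψ₂ X)
    (hfun₁ : Ψ₁.ψ = fun X => (ψ₁ X : ℂ)) (hfun₂ : Ψ₂.ψ = fun X => (ψ₂ X : ℂ)) :
    ∃ Φ : PeriodicTrialState N L,
      Φ.ψ = fun X => ((Real.sqrt (2⁻¹ * (ψ₁ X ^ 2 + ψ₂ X ^ 2)) : ℝ) : ℂ) := by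
  have hm : ContDiff ℝ 1 fun X => 2⁻¹ * (ψ₁ X ^ 2 + ψ₂ X ^ 2) :=
    contDiff_const.mul ((hC₁.pow 2).add (hC₂.pow 2))
  have hm0 : ∀ X, 0 < 2⁻¹ * (ψ₁ X ^ 2 + ψ₂ X ^ 2) := fun X => by
    have := hpos₂ X
    positivity
  have hsq : ∀ X, Real.sqrt (2⁻¹ * (ψ₁ X ^ 2 + ψ₂ X ^ 2)) ^ 2 = 2⁻¹ * (ψ₁ X ^ 2 + ψ₂ X ^ 2) :=
    fun X => Real.sq_sqrt (hm0 X).le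
  have hper₁ := isTorusPeriodic_of_eq Ψ₁ hfun₁
  have hper₂ := isTorusPeriodic_of_eq Ψ₂ hfun₂
  have hmeas : Measurable fun X => ENNReal.ofReal (ψ₁ X ^ 2) :=
    (hC₁.continuous.pow 2).measurable.ennreal_ofReal
  refine ⟨{ ψ := fun X => ((Real.sqrt (2⁻¹ * (ψ₁ X ^ 2 + ψ₂ X ^ 2)) : ℝ) : ℂ)
            contDiff := Complex.ofRealCLM.contDiff.comp (hm.sqrt fun X => (hm0 X).ne')
            periodic := fun X i k => by simp only [hper₁ X i k, hper₂ X i k]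
            symm := fun σ X => by simp only [symm_of_eq Ψ₁ hfun₁ σ X, symm_of_eq Ψ₂ hfun₂ σ X]
            norm_eq := ?_ }, rfl⟩
  simp only [coe_nnnorm_sq_eq_ofReal, Complex.norm_real, Real.norm_eq_abs, sq_abs, hsq]
  calc ∫⁻ X in cellN N L, ENNReal.ofReal (2⁻¹ * (ψ₁ X ^ 2 + ψ₂ X ^ 2))
      = ∫⁻ X in cellN N L, 2⁻¹ * (ENNReal.ofReal (ψ₁ X ^ 2) + ENNReal.ofReal (ψ₂ X ^ 2)) := by
        refine lintegral_congr fun X => ?_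
        rw [ofReal_half_mul, ENNReal.ofReal_add (sq_nonneg _) (sq_nonneg _)]
    _ = 1 := by
        rw [lintegral_const_mul' _ _ (by simp), lintegral_add_left hmeas,
          lintegral_sq_of_eq Ψ₁ hfun₁, lintegral_sq_of_eq Ψ₂ hfun₂, one_add_one_eq_two,
          ENNReal.inv_mul_cancel two_ne_zero (by simp)]

/-! ## The convexity step: the relative Fisher information of two minimisers vanishes -/

/-- **Convexity step.** For two exact minimisers with positive real representatives `ψ₁, ψ₂`
(finite ground-state energy), the relative Fisher information `4∫|∇(ψ₁/ψ₂)|²ψ₂²` over the open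
box `(0,L)^{3N}` vanishes: `E[Φ] + ∫ defect = ½E[Ψ₁] + ½E[Ψ₂] = E₀ ≤ E[Φ]` for
`Φ = √((ψ₁²+ψ₂²)/2)` forces the (weighted) defect `|∇(ψ₁/ψ₂)|² ψ₂⁴/(2(ψ₁²+ψ₂²))` to vanish
almost everywhere on the cell. LSSY2005 Ch. 6 / App. A (uniqueness by convexity). [folklore] -/
theorem fisher_eq_zero_of_minimisers {v : ℝ → ℝ≥0∞} (hv : Measurable v)
    (Ψ₁ Ψ₂ : PeriodicTrialState N L) {ψ₁ ψ₂ : Config N → ℝ}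
    (hC₁ : ContDiff ℝ 1 ψ₁) (hC₂ : ContDiff ℝ 1 ψ₂) (hpos₂ : ∀ X, 0 < ψ₂ X)
    (hfun₁ : Ψ₁.ψ = fun X => (ψ₁ X : ℂ)) (hfun₂ : Ψ₂.ψ = fun X => (ψ₂ X : ℂ))
    (hE₁ : periodicEnergy v Ψ₁ = periodicGroundStateEnergy v N L) (hfin : periodicEnergy v Ψ₁ ≠ ⊤)
    (hE₂ : periodicEnergy v Ψ₂ = periodicGroundStateEnergy v N L) :
    relativeFisherInformation (openBoxN N L) ψ₁ ψ₂ = 0 := by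
  obtain ⟨Φ, hΦ⟩ := exists_meanState Ψ₁ Ψ₂ hC₁ hC₂ hpos₂ hfun₁ hfun₂
  have hm0 : ∀ X, 0 < 2⁻¹ * (ψ₁ X ^ 2 + ψ₂ X ^ 2) := fun X => by
    have := hpos₂ X
    positivity
  -- the defect `D · w`
  set D : Config N → ℝ≥0∞ := fun X => ∑ i : Fin N, ∑ a : Fin 3,
    ((‖fderiv ℝ (fun Y => ψ₁ Y / ψ₂ Y) X (Pi.single i (EuclideanSpace.single a (1 : ℝ)))‖₊ :
      ℝ≥0∞)) ^ 2 with hD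
  set w : Config N → ℝ := fun X => ψ₂ X ^ 4 / (2 * (ψ₁ X ^ 2 + ψ₂ X ^ 2)) with hw
  have hwpos : ∀ X, 0 < w X := fun X => by
    have := hpos₂ X
    simp only [hw]
    positivity
  -- pointwise identity of the energy densities (kinetic: Lagrange; potential: affine)
  have hpt : ∀ X, (kineticDensity Φ.ψ X + periodicInteraction v L X * ((‖Φ.ψ X‖₊ : ℝ≥0∞)) ^ 2) +
      D X * ENNReal.ofReal (w X) =
      2⁻¹ * (kineticDensity Ψ₁.ψ X + periodicInteraction v L X * ((‖Ψ₁.ψ X‖₊ : ℝ≥0∞)) ^ 2) +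
      2⁻¹ * (kineticDensity Ψ₂.ψ X + periodicInteraction v L X * ((‖Ψ₂.ψ X‖₊ : ℝ≥0∞)) ^ 2) := by
    intro X
    have hkin : kineticDensity Φ.ψ X + D X * ENNReal.ofReal (w X) =
        2⁻¹ * kineticDensity Ψ₁.ψ X + 2⁻¹ * kineticDensity Ψ₂.ψ X := by
      rw [hΦ, hfun₁, hfun₂]
      exact kinetic_identity hC₁ hC₂ hpos₂ X
    have hnorm : ((‖Φ.ψ X‖₊ : ℝ≥0∞)) ^ 2 =
        2⁻¹ * ((‖Ψ₁.ψ X‖₊ : ℝ≥0∞)) ^ 2 + 2⁻¹ * ((‖Ψ₂.ψ X‖₊ : ℝ≥0∞)) ^ 2 := by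
      rw [hΦ, hfun₁, hfun₂]
      simp only [coe_nnnorm_sq_eq_ofReal, Complex.norm_real, Real.norm_eq_abs, sq_abs]
      rw [Real.sq_sqrt (hm0 X).le, ofReal_half_mul, ENNReal.ofReal_add (sq_nonneg _) (sq_nonneg _),
        mul_add]
    rw [hnorm]
    calc _ = (kineticDensity Φ.ψ X + D X * ENNReal.ofReal (w X)) + periodicInteraction v L X *
          (2⁻¹ * ((‖Ψ₁.ψ X‖₊ : ℝ≥0∞)) ^ 2 + 2⁻¹ * ((‖Ψ₂.ψ X‖₊ : ℝ≥0∞)) ^ 2) := by ring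
      _ = _ := by rw [hkin]; ring
  -- measurability of the defect
  have hmeasD : Measurable fun X => D X * ENNReal.ofReal (w X) := by
    refine Measurable.mul ?_ ?_
    · refine Finset.measurable_sum _ fun i _ => Finset.measurable_sum _ fun a _ => ?_
      exact ((measurable_fderiv_apply_const ℝ (fun Y => ψ₁ Y / ψ₂ Y)
        (Pi.single i (EuclideanSpace.single a (1 : ℝ)))).nnnorm.coe_nnreal_ennreal).pow_const 2
    · exact (Continuous.div (hC₂.continuous.pow 4)
        (continuous_const.mul ((hC₁.continuous.pow 2).add (hC₂.continuous.pow 2)))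
        fun X => (mul_pos two_pos (add_pos_of_nonneg_of_pos (sq_nonneg _)
          (pow_pos (hpos₂ X) 2))).ne').measurable.ennreal_ofReal
  -- measurability of the energy densities (measurable `v`, `C¹` states)
  have hmeasV : Measurable (periodicInteraction (N := N) v L) := by
    unfold periodicInteraction periodizedPotential
    refine Finset.measurable_sum _ fun i _ => Finset.measurable_sum _ fun j _ => ?_
    exact Measurable.tsum fun n =>
      hv.comp (((measurable_pi_apply i).sub (measurable_pi_apply j)).sub_const _).norm
  have hmeasE : ∀ Ψ : PeriodicTrialState N L, Measurable fun X =>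
      kineticDensity Ψ.ψ X + periodicInteraction v L X * ((‖Ψ.ψ X‖₊ : ℝ≥0∞)) ^ 2 := fun Ψ =>
    (measurable_kineticDensity Ψ.contDiff).add
      (hmeasV.mul (measurable_ennnormSq Ψ.contDiff.continuous))
  -- the energy identity `E[Φ] + ∫ defect = ½E[Ψ₁] + ½E[Ψ₂] = E₀`
  have hhalf : (2 : ℝ≥0∞)⁻¹ ≠ ⊤ := by simp
  have hsum : periodicEnergy v Φ + ∫⁻ X in cellN N L, D X * ENNReal.ofReal (w X) =
      2⁻¹ * periodicEnergy v Ψ₁ + 2⁻¹ * periodicEnergy v Ψ₂ := by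
    unfold periodicEnergy
    rw [← lintegral_add_left (hmeasE Φ), lintegral_congr hpt,
      lintegral_add_left ((hmeasE Ψ₁).const_mul _),
      lintegral_const_mul' _ _ hhalf, lintegral_const_mul' _ _ hhalf]
  rw [hE₁, hE₂, ← add_mul, ENNReal.inv_two_add_inv_two, one_mul] at hsum
  -- the variational principle squeezes the defect integral to zero
  have htop : periodicGroundStateEnergy v N L ≠ ⊤ := hE₁ ▸ hfin
  have hI0 : ∫⁻ X in cellN N L, D X * ENNReal.ofReal (w X) = 0 := by
    refine le_antisymm ((ENNReal.add_le_add_iff_left htop).1 ?_) bot_le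
    rw [add_zero]
    calc periodicGroundStateEnergy v N L + ∫⁻ X in cellN N L, D X * ENNReal.ofReal (w X)
        ≤ periodicEnergy v Φ + ∫⁻ X in cellN N L, D X * ENNReal.ofReal (w X) :=
          add_le_add (periodicGroundStateEnergy_le v Φ) le_rfl
      _ = periodicGroundStateEnergy v N L := hsum
  have hae : ∀ᵐ X ∂(volume.restrict (cellN N L)), D X * ENNReal.ofReal (w X) = 0 :=
    (lintegral_eq_zero_iff hmeasD).1 hI0
  have hae' : ∀ᵐ X ∂(volume.restrict (openBoxN N L)), relFisherDensity ψ₁ ψ₂ X = 0 := by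
    filter_upwards [ae_restrict_of_ae_restrict_of_subset (openBoxN_subset_cellN N L) hae]
      with X hX
    have hw0 : ENNReal.ofReal (w X) ≠ 0 := (ENNReal.ofReal_pos.2 (hwpos X)).ne'
    have hD0 : (∑ i : Fin N, ∑ a : Fin 3, ((‖fderiv ℝ (fun Y => ψ₁ Y / ψ₂ Y) X
        (Pi.single i (EuclideanSpace.single a (1 : ℝ)))‖₊ : ℝ≥0∞)) ^ 2) = 0 := by
      simpa only [hD] using (mul_eq_zero.1 hX).resolve_right hw0
    rw [relFisherDensity, hD0, mul_zero, zero_mul]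
  unfold relativeFisherInformation
  rw [lintegral_congr_ae (g := fun _ => 0) hae', lintegral_zero]

/-- **Extension.** If two continuous torus-periodic functions satisfy `ψ₁ = cψ₂` on the open box
`(0,L)^{3N}`, then `ψ₁ = cψ₂` everywhere: on the half-open cell by continuity along the segment
towards the centre of the box, and on `(ℝ³)^N` by periodicity (every configuration is a lattice
translate of a point of the cell). [folklore] -/
theorem eq_const_mul_of_eqOn_openBoxN (hL : 0 < L) {ψ₁ ψ₂ : Config N → ℝ}
    (hc₁ : Continuous ψ₁) (hc₂ : Continuous ψ₂)
    (hper₁ : IsTorusPeriodic L ψ₁) (hper₂ : IsTorusPeriodic L ψ₂) {c : ℝ}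
    (h : ∀ X ∈ openBoxN N L, ψ₁ X = c * ψ₂ X) (X : Config N) : ψ₁ X = c * ψ₂ X := by
  -- on the cell
  have hcell : ∀ Y ∈ cellN N L, ψ₁ Y = c * ψ₂ Y := by
    intro Y hY
    set C : Config N := fun _ => (WithLp.toLp 2 (fun _ : Fin 3 => L / 2) : Space) with hCdef
    set γ : ℝ → Config N := fun t => Y + t • (C - Y) with hγ
    have hseg : ∀ t ∈ Set.Ioo (0 : ℝ) 1, γ t ∈ openBoxN N L := by
      intro t ht i a
      have h0 := (hY i a).1
      have h1 := (hY i a).2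
      simp only [hγ, hCdef, Pi.add_apply, Pi.smul_apply, Pi.sub_apply, PiLp.add_apply,
        PiLp.smul_apply, PiLp.sub_apply, smul_eq_mul, Set.mem_Ioo]
      constructor
      · nlinarith [mul_nonneg (sub_nonneg.2 ht.2.le) h0, mul_pos ht.1 hL]
      · nlinarith [mul_le_mul_of_nonneg_left h1.le (sub_nonneg.2 ht.2.le), mul_pos ht.1 hL]
    have hγc : Continuous γ := continuous_const.add (continuous_id.smul continuous_const)
    have hEq : Set.EqOn (fun t => ψ₁ (γ t)) (fun t => c * ψ₂ (γ t)) (Set.Ioo 0 1) :=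
      fun t ht => h _ (hseg t ht)
    have h0mem : (0 : ℝ) ∈ closure (Set.Ioo (0 : ℝ) 1) := by
      rw [closure_Ioo zero_ne_one]
      exact ⟨le_rfl, zero_le_one⟩
    simpa [hγ] using hEq.closure (hc₁.comp hγc) (continuous_const.mul (hc₂.comp hγc)) h0mem
  -- everywhere, by periodicity
  have hred : ∀ {ψ : Config N → ℝ}, IsTorusPeriodic L ψ →
      ψ X = ψ (X - latticeVecN L (cellIndex L X)) := fun hper => by
    conv_lhs => rw [← sub_add_cancel X (latticeVecN L (cellIndex L X))]
    exact hper.add_latticeVecN _ _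
  rw [hred hper₁, hred hper₂]
  exact hcell _ (sub_latticeVecN_cellIndex_mem_cellN hL X)

end PositiveMinimiserUnique

open PositiveMinimiserUnique in
/-- **S6 `stub_positiveMinimiserUnique` (uniqueness of the positive minimiser).** On the torus of
side `L > 0`, two exact minimisers of the periodic `(n+1)`-body energy (measurable `v`, finite
ground-state energy) that are both real non-negative and nowhere zero coincide. Proof: with the
positive real representatives `ψᵢ` (`Ψᵢ = ψᵢ`), the mean-density state `Φ = √((ψ₁²+ψ₂²)/2)` is
admissible and `E[Φ] = E₀ - ∫ defect` by the pointwise Lagrange identity (convexity of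
`ρ ↦ |∇√ρ|²`, the potential term being affine in `ρ`); the variational principle kills the defect,
so the relative Fisher information of `ψ₁²` w.r.t. `ψ₂²` vanishes on the open box, `ψ₁ = cψ₂`
there (mean value theorem), hence on the cell by continuity and everywhere by periodicity;
`c = 1` by normalisation. Source: LSSY2005, Ch. 6, Thm. 6.1 / App. A; ReedSimonIV1978 §XIII.12. -/
theorem stub_positiveMinimiserUnique :
    ∀ v : ℝ → ℝ≥0∞, Measurable v → ∀ n : ℕ, ∀ L : ℝ, 0 < L →
      ∀ Ψ₁ Ψ₂ : PeriodicTrialState (n + 1) L,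
        periodicEnergy v Ψ₁ = periodicGroundStateEnergy v (n + 1) L → periodicEnergy v Ψ₁ ≠ ⊤ →
        (∀ X, Ψ₁.ψ X = (‖Ψ₁.ψ X‖ : ℂ)) → (∀ X, Ψ₁.ψ X ≠ 0) →
        periodicEnergy v Ψ₂ = periodicGroundStateEnergy v (n + 1) L →
        (∀ X, Ψ₂.ψ X = (‖Ψ₂.ψ X‖ : ℂ)) → (∀ X, Ψ₂.ψ X ≠ 0) →
        Ψ₁ = Ψ₂ := by
  intro v hv n L hL Ψ₁ Ψ₂ hE₁ hfin hreal₁ hne₁ hE₂ hreal₂ hne₂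
  obtain ⟨ψ₁, hC₁, hpos₁, hfun₁⟩ := exists_realRep Ψ₁ hreal₁ hne₁
  obtain ⟨ψ₂, hC₂, hpos₂, hfun₂⟩ := exists_realRep Ψ₂ hreal₂ hne₂
  have hI := fisher_eq_zero_of_minimisers hv Ψ₁ Ψ₂ hC₁ hC₂ hpos₂ hfun₁ hfun₂ hE₁ hfin hE₂
  obtain ⟨c, hc⟩ := exists_eq_const_mul_of_relativeFisherInformation_eq_zero
    (isOpen_openBoxN (n + 1) L) (convex_openBoxN (n + 1) L).isPreconnected hC₁ hC₂
    (fun X _ => (hpos₂ X).ne') hI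
  have hc' : ∀ X, ψ₁ X = c * ψ₂ X :=
    eq_const_mul_of_eqOn_openBoxN hL hC₁.continuous hC₂.continuous
      (isTorusPeriodic_of_eq Ψ₁ hfun₁) (isTorusPeriodic_of_eq Ψ₂ hfun₂) hc
  -- `c = 1` by normalisation and positivity
  have hcpos : 0 < c := by
    have h0 := hc' 0
    nlinarith [hpos₁ 0, hpos₂ 0]
  have hc2 : ENNReal.ofReal (c ^ 2) = 1 := by
    calc ENNReal.ofReal (c ^ 2)
        = ENNReal.ofReal (c ^ 2) * ∫⁻ X in cellN (n + 1) L, ENNReal.ofReal (ψ₂ X ^ 2) := by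
          rw [lintegral_sq_of_eq Ψ₂ hfun₂, mul_one]
      _ = ∫⁻ X in cellN (n + 1) L, ENNReal.ofReal (c ^ 2) * ENNReal.ofReal (ψ₂ X ^ 2) :=
          (lintegral_const_mul' _ _ ENNReal.ofReal_ne_top).symm
      _ = ∫⁻ X in cellN (n + 1) L, ENNReal.ofReal (ψ₁ X ^ 2) := by
          refine lintegral_congr fun X => ?_
          rw [hc' X, mul_pow, ENNReal.ofReal_mul (sq_nonneg _)]
      _ = 1 := lintegral_sq_of_eq Ψ₁ hfun₁
  have hc1 : c = 1 :=
    (pow_eq_one_iff_of_nonneg hcpos.le two_ne_zero).1 (ENNReal.ofReal_eq_one.1 hc2)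
  -- conclude
  refine trialState_eq_of_eq ?_
  rw [hfun₁, hfun₂]
  funext X
  rw [hc' X, hc1, one_mul]

end Summit.AtomisticToContinuum.BoseEinsteinCondensation.Theorems

end
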